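import Summits.BirchSwinnertonDyer.BirchSwinnertonDyer.Theorems.CMKolyvaginAtInertTwoPairAssemblyCMInertNegOfKillAtTwo
import Summits.BirchSwinnertonDyer.BirchSwinnertonDyer.Theorems.CMKolyvaginAtInertTwoPairAssemblyShaReadingAtTwo
import HarnessLib

/-!
# Route `CMKolyvaginAtInertTwo`, crux `CMKolyvaginExactAtInertTwo` (stmt-BirchSwinnertonDyer-24277):
# `stub_upper`'s conclusion in the ROOT-NUMBER BRANCH `w(E/ℚ) = +1`, modulo the route's facts and the supplier's inputs
# (KERNEL-STATUS-p2-port.md §17.13, step S6)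

Seat `bsd-line-cmk2-p1` g17 (cell `bsd-print-cf2`); helper (`--supports stmt-BirchSwinnertonDyer-24277`).
THEOREMS ONLY: no definition, no named fact, no `sorry`; no item is closed; BSD is not proved by this.

`…PairAssemblyShaReadingAtTwo` (p723024) with the two members exchanged (the twin `E^{(d_K)}` holds `x`; Kolyvagin's class of
`y_K` is `τ`-anti-invariant when `w(E/ℚ) = +1`): `…_cmInert_neg_of_finite` (S5) read as `#Ш(E^{(d_K)})(2)·#Ш(E)(2) ≤ 2^{2·D.M₀}`,
then — the product commuted — g16's `card_primaryComponent_sha_two_baseChange_le_pow_of_pair_le_of_facts` (p705380, symmetric in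
the pair) gives `#Ш(E_K)(2) ≤ 2^{2·D.M₀}`. Together with p723024 BOTH root-number branches of the crux now end in the registered
`stub_upper` conclusion modulo GZ/GZK/mod/Milne and the supplier's inputs (branch `−1`: `E`-first data; branch `+1`: twin-first data).

* `card_primaryComponent_mul_le_two_pow_of_pairData_cmInert_neg`, `card_primaryComponent_sha_two_baseChange_le_pow_of_pairData_cmInert_neg_of_facts`.

References: [McCallumLMS1991] §1 Theorem, §5 Thm. 5.4, Cor. 5.6; [Kolyvagin1989Izv] §3; [GrossLMS1991] Prop. 5.4 (2);
[MilneADT2006] I §6 Thm. 6.13 (a); [Milne1972ArithmeticAV] §1 Thm. 1.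
-/

set_option linter.dupNamespace false
set_option autoImplicit false

noncomputable section

open scoped Classical
open scoped AddSubgroup
open WeierstrassCurve NumberField IsDedekindDomain Field Function Rat.HeightOneSpectrum
open Literature.NumberTheory.GaloisRepresentations
open Literature.NumberTheory.GaloisCohomology
open Literature.NumberTheory.EllipticCurves Literature.NumberTheory.EllipticCurves.KolyvaginDescent
open Summit.BirchSwinnertonDyer.BirchSwinnertonDyer.Theorems.GenusExact.EigenClassesFinite
open Summit.BirchSwinnertonDyer.BirchSwinnertonDyer.Theorems.GenusExact.VisiblePairAtTwo

namespace Summit.BirchSwinnertonDyer.BirchSwinnertonDyer.Theorems.KolyvaginPairDataTwo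

variable (W : WeierstrassCurve ℚ) {K : Type} [Field K] [NumberField K]

set_option maxHeartbeats 1600000 in
/-- **`#Ш(E^{(d_K)})(2) · #Ш(E)(2) ≤ 2^{2M₀}` on H₂ in the root-number branch `w(E/ℚ) = +1`** from twin-first two-member
descent data, a Heegner point, the finiteness of the two `Ш` (with `L ≥ v₂ #Ш`, `L ≥ M₀`, `L ≥ 1`) and the point-free Mordell–Weil
inputs (`hkerT` on `Sel(E^{(d_K)})`, `hinjT` on `Sel(E)`): `…_cmInert_neg_of_finite` read through `Ш[2^L] = Ш(2)` and
`Sel_{2^{2L}}(E) ≅ Ш(E)[2^L]`. [cite: McCallumLMS1991, §1 Theorem, §5 Thm. 5.4, Cor. 5.6] [cite: Kolyvagin1989Izv, §3]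
[cite: MilneADT2006, Ch. I §6 Thm. 6.13 (a)] -/
theorem card_primaryComponent_mul_le_two_pow_of_pairData_cmInert_neg
    [W.IsElliptic] [W.IsGloballyMinimal] [NeZero (W.conductorNorm ℤ)] [(twin W K).IsElliptic]
    (hCM : W.HasCM) (hin : Literature.NumberTheory.EllipticCurves.Rank1Residual.CMInert W 2)
    (hρ : W.HasSurjectiveModNGaloisRep 2) (hK : IsImaginaryQuadratic K) (hoddK : Odd (NumberField.discr K))
    (hH : SatisfiesHeegnerHypothesis (W.conductorNorm ℤ) K)
    {P₀ : (W.baseChange K).toAffine.Point} (hP₀ : IsHeegnerPoint (W.conductorNorm ℤ) W K P₀)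
    {L : ℕ} (hL1 : 1 ≤ L)
    -- the two-member descent data on the `ℚ`-pair carrier
    (D : PairDataM (galH1Torsion (twin W K) (lvl (L + L))) (galH1Torsion W (lvl (L + L)))
      (HeightOneSpectrum (𝓞 ℚ) ⊕ InfinitePlace ℚ))
    (hDp : D.p = 2) (hDM : D.M = L + L)
    (hDSel₁ : D.Sel₁ = selmerGroup (twin W K) (lvl (L + L)))
    (hDSel₂ : D.Sel₂ = selmerGroup W (lvl (L + L)))
    (hDLoc₁ : D.Loc₁ = loc₂ W K (L + L)) (hDLoc₂ : D.Loc₂ = loc₁ W (L + L))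
    (hDA₁ : D.A₁ = a₂ W K (L + L)) (hDA₂ : D.A₂ = a₁ W (L + L))
    (hDpl : D.pl = pl) (hDDv : D.Dv = Dv)
    (hDKol : ∀ ℓ, D.Kol ℓ ↔ IsKolyvaginPrime (W.conductorNorm ℤ) W K 2 ℓ ∧
      FrobEqFrobInfty W K (2 ^ (L + L + 1)) ℓ ∧ kolPrime W K (L + L) ℓ)
    (hM₀L : D.M₀ ≤ L)
    -- finiteness of the two Tate–Shafarevich groups, `L` beyond their `2`-adic size
    [Finite (twin W K).sha] [Finite W.sha]
    (hLsha₁ : padicValNat 2 (Nat.card (twin W K).sha) ≤ L) (hLsha₂ : padicValNat 2 (Nat.card W.sha) ≤ L)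
    -- rank one on `E`: the kernel of `Sel_{2^{2L}}(E) → H¹(ℚ, E)` is `ℤ · D.x`; rank zero on `E^{(d_K)}`: that kernel vanishes
    (hkerT : ∀ z : selmerGroup (twin W K) (lvl (L + L)),
      torsionH1ToH1 (twin W K) (lvl (L + L)) z = 0 ↔ (z : galH1Torsion (twin W K) (lvl (L + L))) ∈ AddSubgroup.zmultiples D.x)
    (hinjT : ∀ z : selmerGroup W (lvl (L + L)), torsionH1ToH1 W (lvl (L + L)) z = 0 → z = 0) :
    Nat.card (AddCommGroup.primaryComponent (twin W K).sha 2) *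
      Nat.card (AddCommGroup.primaryComponent W.sha 2) ≤ 2 ^ (2 * D.M₀) := by
  have h := card_mul_card_le_two_pow_two_mul_of_pairData_cmInert_neg_of_finite W hCM hin hρ hK hoddK hH hP₀ hL1 D hDp hDM hDSel₁
    hDSel₂ hDLoc₁ hDLoc₂ hDA₁ hDA₂ hDpl hDDv hDKol hM₀L hLsha₁ hLsha₂ hkerT hinjT
  -- `Sel_{2^{2L}}(E^{(d_K)}) ≅ Ш(E^{(d_K)})[2^L]`
  obtain ⟨ι₂, hι₂⟩ := exists_selmerToSha_of_finite W hLsha₂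
  have hinj : Function.Injective ι₂ := by
    refine (injective_iff_map_eq_zero ι₂).mpr fun z hz ↦ hinjT z ?_
    rw [← hι₂ z, hz]
    rfl
  have hcard₂ : Nat.card (selmerGroup W (lvl (L + L))) = Nat.card ((W.sha)[(2 ^ L : ℕ)]) :=
    Nat.card_congr (Equiv.ofBijective ι₂ ⟨hinj, selmerToSha_surjective W ι₂ hι₂⟩)
  rw [hcard₂, natCard_torsionBy_two_pow_eq_of_padicValNat_le hLsha₁, natCard_torsionBy_two_pow_eq_of_padicValNat_le hLsha₂] at h
  exact h


set_option maxHeartbeats 1600000 in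
/-- **THE REGISTERED `stub_upper` CONCLUSION `#Ш(E_K)(2) ≤ 2^{2·D.M₀}` IN THE ROOT-NUMBER BRANCH `w(E/ℚ) = +1`, MODULO
the route's published inputs (Gross–Zagier all levels, GZK, modularity, Milne) AND the supplier's inputs** (twin-first
two-member descent data `D`, a Heegner point, a Heegner datum `d₁` with `y_K` of infinite order, prime `|d_K|`, finiteness of the
two `Ш` with `v₂ #Ш ≤ L`, `hkerT` on `Sel(E^{(d_K)})`, `hinjT` on `Sel(E)`): `card_primaryComponent_mul_le_two_pow_of_pairData_cmInert_neg`
(product commuted) fed into g16's `ShaCountTwo.card_primaryComponent_sha_two_baseChange_le_pow_of_pair_le_of_facts` (p705380).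
[cite: McCallumLMS1991, §1 Theorem, §5 Thm. 5.4 "≤"] [cite: Milne1972ArithmeticAV, §1 Thm. 1] [cite: Kolyvagin1989Izv, §3] -/
theorem card_primaryComponent_sha_two_baseChange_le_pow_of_pairData_cmInert_neg_of_facts
    -- the route's published inputs (items 24148 / 19921 / 19273 / 24149)
    (hGZ : ∀ (N : ℕ) [NeZero N] (W : WeierstrassCurve ℚ) (K : Type) [Field K] [NumberField K], gross_zagier N W K)
    (hGZK : rank_eq_analyticRank_of_analyticRank_le_one) (hmod : hasEntireLFunction_rat)
    (hMilneC : Milne1972.bsdQuotient_baseChange_quadratic_anyModel)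
    [W.IsElliptic] [W.IsGloballyMinimal] [NeZero (W.conductorNorm ℤ)] [(twin W K).IsElliptic]
    (hCM : W.HasCM) (hin : Literature.NumberTheory.EllipticCurves.Rank1Residual.CMInert W 2)
    (hρ : W.HasSurjectiveModNGaloisRep 2) (hK : IsImaginaryQuadratic K) (hoddK : Odd (NumberField.discr K))
    (hH : SatisfiesHeegnerHypothesis (W.conductorNorm ℤ) K)
    {P₀ : (W.baseChange K).toAffine.Point} (hP₀ : IsHeegnerPoint (W.conductorNorm ℤ) W K P₀)
    {L : ℕ} (hL1 : 1 ≤ L)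
    -- the two-member descent data on the `ℚ`-pair carrier
    (D : PairDataM (galH1Torsion (twin W K) (lvl (L + L))) (galH1Torsion W (lvl (L + L)))
      (HeightOneSpectrum (𝓞 ℚ) ⊕ InfinitePlace ℚ))
    (hDp : D.p = 2) (hDM : D.M = L + L)
    (hDSel₁ : D.Sel₁ = selmerGroup (twin W K) (lvl (L + L)))
    (hDSel₂ : D.Sel₂ = selmerGroup W (lvl (L + L)))
    (hDLoc₁ : D.Loc₁ = loc₂ W K (L + L)) (hDLoc₂ : D.Loc₂ = loc₁ W (L + L))
    (hDA₁ : D.A₁ = a₂ W K (L + L)) (hDA₂ : D.A₂ = a₁ W (L + L))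
    (hDpl : D.pl = pl) (hDDv : D.Dv = Dv)
    (hDKol : ∀ ℓ, D.Kol ℓ ↔ IsKolyvaginPrime (W.conductorNorm ℤ) W K 2 ℓ ∧
      FrobEqFrobInfty W K (2 ^ (L + L + 1)) ℓ ∧ kolPrime W K (L + L) ℓ)
    (hM₀L : D.M₀ ≤ L)
    -- finiteness of the two Tate–Shafarevich groups, `L` beyond their `2`-adic size
    [Finite (twin W K).sha] [Finite W.sha]
    (hLsha₁ : padicValNat 2 (Nat.card (twin W K).sha) ≤ L) (hLsha₂ : padicValNat 2 (Nat.card W.sha) ≤ L)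
    -- rank one on `E`: the kernel of `Sel_{2^{2L}}(E) → H¹(ℚ, E)` is `ℤ · D.x`; rank zero on `E^{(d_K)}`: that kernel vanishes
    (hkerT : ∀ z : selmerGroup (twin W K) (lvl (L + L)),
      torsionH1ToH1 (twin W K) (lvl (L + L)) z = 0 ↔ (z : galH1Torsion (twin W K) (lvl (L + L))) ∈ AddSubgroup.zmultiples D.x)
    (hinjT : ∀ z : selmerGroup W (lvl (L + L)), torsionH1ToH1 W (lvl (L + L)) z = 0 → z = 0)
    (hq : (NumberField.discr K).natAbs.Prime)
    (Dt : Literature.NumberTheory.EllipticCurves.ModularForms.ModularParametrizationData W (W.conductorNorm ℤ)) (β : ℤ)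
    (ιK : K →+* ℂ) (d₁ : KolyvaginHeegnerData Dt β ιK 1) (hy : ¬ IsOfFinAddOrder d₁.derivedPoint) :
    Nat.card (AddCommGroup.primaryComponent (W.baseChange K).sha 2) ≤ 2 ^ (2 * D.M₀) :=
  ShaCountTwo.card_primaryComponent_sha_two_baseChange_le_pow_of_pair_le_of_facts hGZ hGZK hmod hMilneC W hCM hin hρ K hK hoddK
    hH hq Dt β ιK d₁ hy
    (by
      rw [mul_comm]
      exact card_primaryComponent_mul_le_two_pow_of_pairData_cmInert_neg W hCM hin hρ hK hoddK hH hP₀ hL1 D hDp hDM hDSel₁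
        hDSel₂ hDLoc₁ hDLoc₂ hDA₁ hDA₂ hDpl hDDv hDKol hM₀L hLsha₁ hLsha₂ hkerT hinjT)

end Summit.BirchSwinnertonDyer.BirchSwinnertonDyer.Theorems.KolyvaginPairDataTwo

end
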